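import Mathlib
import Summits.Ventures.PercRepro2.SwOutMixedArmsClosureSlice

/-!
# The several-arms big-block lemma under the GEOMETRIC closure, pure arms (blind cell PercRepro2,
night-4 g21, 2026-08-27; proofs/NIGHT4-G21.md §3)

**`pureArms_card_le`**: for a junction with any number of u-arms (one at least), any number of
PURE arms (dropped vertices without pieces: `IsEmpty ν`) and any number of far arms, every set
`Q` of points of the raw cube `PtR ι ρ ν κ` that is closed, between non-leaking points, under
the raw-lower moves with the u–p condition (`ArmLower`, the closure of
`MixedBaseR.mem_tgtU_of_le`) and under raising `uP` (`RaiseUP`, the closure of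
`MixedBaseR.mem_tgtU_of_uP_le`) satisfies, for every up-set `𝓔` of atom sets,
`#{p ∈ Q : ¬ Leak p ∧ ER p ∈ 𝓔} ≤ #{p ∈ Q : ¬ Leak p ∧ EB p ∈ 𝓔}`.  No lowerness in `uP` at
unmixed `s` and no `G5` are assumed: this is the abstract theorem with the hypothesis the
several-arms geometry does satisfy (NIGHT4-G20.md §4″, where the block-lower hypothesis of
`mixedArms_card_le` was shown NOT to lift for two arms).  Proof: the slice inequality
(`slice_card_le`) summed over the far arms (`frozen_card_le`), then the far arms flipped by the
cube principle on each fibre of the other coordinates (`far_card_le`).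
**`card_le_of_pureArms_edges`**: the edge-set interface (the twin of
`card_le_of_mixedArms_edges` with the geometric closure as hypothesis).
-/

namespace Summit.Ventures.PercRepro2

namespace MixedArms

open scoped Classical

variable {ι ρ ν κ : Type*}

section Sum

variable [IsEmpty ν] [Nonempty ι] [Fintype ι] [DecidableEq ι] [Fintype ρ] [DecidableEq ρ]
  [Fintype ν] [DecidableEq ν] [Fintype κ] [DecidableEq κ] {arm : ν → ρ} {Q : Set (PtR ι ρ ν κ)}

/-- **The inequality with the `f`-frozen blue set**: the slice inequality summed over the far
arms. -/
theorem frozen_card_le (hL : ArmLower arm Q) (hR : RaiseUP arm Q)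
    {𝓔 : Set (Set (AtomR ι ρ ν κ))} (h𝓔 : IsUpperSet 𝓔) :
    N (fun q : PtR ι ρ ν κ => q ∈ Q ∧ ¬ Leak q arm ∧ ER q ∈ 𝓔) ≤
      N (fun q : PtR ι ρ ν κ => q ∈ Q ∧ ¬ Leak q arm ∧ EBT ∅ q ∈ 𝓔) := by
  rw [N_eq_sum_fiber (fun q : PtR ι ρ ν κ => q.2.2.2.2)
      (fun q : PtR ι ρ ν κ => q ∈ Q ∧ ¬ Leak q arm ∧ ER q ∈ 𝓔),
    N_eq_sum_fiber (fun q : PtR ι ρ ν κ => q.2.2.2.2)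
      (fun q : PtR ι ρ ν κ => q ∈ Q ∧ ¬ Leak q arm ∧ EBT ∅ q ∈ 𝓔)]
  apply Finset.sum_le_sum
  intro f₀ _
  have key := slice_card_le hL hR h𝓔 f₀
  refine le_of_eq_of_le (N_congr fun q => ?_) (le_trans key (le_of_eq (N_congr fun q => ?_)))
  · exact ⟨fun ⟨⟨h1, h2, h3⟩, h4⟩ => ⟨h1, h2, h4, h3⟩, fun ⟨h1, h2, h4, h3⟩ => ⟨⟨h1, h2, h3⟩, h4⟩⟩
  · exact ⟨fun ⟨h1, h2, h4, h3⟩ => ⟨⟨h1, h2, h3⟩, h4⟩, fun ⟨⟨h1, h2, h3⟩, h4⟩ => ⟨h1, h2, h4, h3⟩⟩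

/-- The four coordinates other than the far arms. -/
abbrev Rest (ι ρ ν : Type*) := Config ι × Config ν × (ρ → Bool) × (ρ → Bool)

/-- A point from its first four coordinates and its far arms. -/
def mkPt (b : Rest ι ρ ν) (f : Config κ) : PtR ι ρ ν κ := (b.1, b.2.1, b.2.2.1, b.2.2.2, f)

/-- The first four coordinates of a point. -/
def rest (q : PtR ι ρ ν κ) : Rest ι ρ ν := (q.1, q.2.1, q.2.2.1, q.2.2.2.1)

/-- The flip of the first four coordinates. -/
def flipRest (b : Rest ι ρ ν) : Rest ι ρ ν :=
  (flipAll b.1, flipAll b.2.1, fun r => !b.2.2.1 r, fun r => !b.2.2.2 r)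

omit [IsEmpty ν] [Nonempty ι] [Fintype ι] [DecidableEq ι] [Fintype ρ] [DecidableEq ρ]
  [Fintype ν] [DecidableEq ν] [Fintype κ] in
/-- The `f`-frozen flip of `mkPt b f` is `mkPt (flipRest b) f`. -/
lemma flipT_empty_mkPt (b : Rest ι ρ ν) (f : Config κ) :
    flipT ∅ (mkPt b f : PtR ι ρ ν κ) = mkPt (flipRest b) f := by
  simp only [flipT, mkPt, flipRest, Prod.mk.injEq, true_and]
  funext k
  simp only [Finset.notMem_empty, if_false]

omit [IsEmpty ν] [Nonempty ι] [Fintype ι] [DecidableEq ι] [Fintype ρ] [DecidableEq ρ]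
  [Fintype ν] [DecidableEq ν] [Fintype κ] [DecidableEq κ] in
/-- The total flip of `mkPt b f` is `mkPt (flipRest b) (flipAll f)`. -/
lemma flipPt_mkPt (b : Rest ι ρ ν) (f : Config κ) :
    flipPt (mkPt b f : PtR ι ρ ν κ) = mkPt (flipRest b) (flipAll f) := rfl

omit [IsEmpty ν] [Nonempty ι] [Fintype ι] [DecidableEq ι] [Fintype ρ] [DecidableEq ρ]
  [Fintype ν] [DecidableEq ν] [Fintype κ] [DecidableEq κ] in
/-- `mkPt b` is monotone in the far arms. -/
lemma mkPt_mono (b : Rest ι ρ ν) {f f' : Config κ} (h : f ≤ f') :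
    (mkPt b f : PtR ι ρ ν κ) ≤ mkPt b f' := ⟨le_rfl, le_rfl, le_rfl, le_rfl, h⟩

omit [IsEmpty ν] [Nonempty ι] [Fintype ι] [DecidableEq ι] [Fintype ρ] [DecidableEq ρ]
  [Fintype ν] [DecidableEq ν] [Fintype κ] [DecidableEq κ] in
/-- Leaking does not depend on the far arms. -/
lemma leak_mkPt_iff (b : Rest ι ρ ν) (f f' : Config κ) :
    Leak (mkPt b f : PtR ι ρ ν κ) arm ↔ Leak (mkPt b f' : PtR ι ρ ν κ) arm := Iff.rfl

omit [IsEmpty ν] [Nonempty ι] in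
/-- **The far-arm step**: on every fibre of the other coordinates the far arms form a lower set of
a cube on which the `f`-frozen blue set is monotone and the blue set is its flip, so the cube
principle carries the frozen count to the blue count. -/
theorem far_card_le (hL : ArmLower arm Q) {𝓔 : Set (Set (AtomR ι ρ ν κ))}
    (h𝓔 : IsUpperSet 𝓔) :
    N (fun q : PtR ι ρ ν κ => q ∈ Q ∧ ¬ Leak q arm ∧ EBT ∅ q ∈ 𝓔) ≤
      N (fun q : PtR ι ρ ν κ => q ∈ Q ∧ ¬ Leak q arm ∧ EB q ∈ 𝓔) := by
  rw [N_eq_sum_fiber (rest (ι := ι) (ρ := ρ) (ν := ν) (κ := κ))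
      (fun q : PtR ι ρ ν κ => q ∈ Q ∧ ¬ Leak q arm ∧ EBT ∅ q ∈ 𝓔),
    N_eq_sum_fiber (rest (ι := ι) (ρ := ρ) (ν := ν) (κ := κ))
      (fun q : PtR ι ρ ν κ => q ∈ Q ∧ ¬ Leak q arm ∧ EB q ∈ 𝓔)]
  apply Finset.sum_le_sum
  intro b _
  rw [N_fiber_eq rest mkPt (fun q : PtR ι ρ ν κ => q.2.2.2.2) (fun _ _ => rfl) (fun _ _ => rfl)
      (fun _ => rfl),
    N_fiber_eq rest mkPt (fun q : PtR ι ρ ν κ => q.2.2.2.2) (fun _ _ => rfl) (fun _ _ => rfl)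
      (fun _ => rfl)]
  have hEv : IsLowerSet {f : Config κ | (mkPt b f : PtR ι ρ ν κ) ∈ Q ∧ ¬ Leak (mkPt b f) arm} := by
    intro f f' hle hf
    have hL' : ¬ Leak (mkPt b f' : PtR ι ρ ν κ) arm := (leak_mkPt_iff b f' f).not.2 hf.2
    exact ⟨hL (mkPt b f) (mkPt b f') hf.2 hL' (mkPt_mono b hle) (fun _ => Or.inl rfl) hf.1, hL'⟩
  have hA : IsUpperSet {f : Config κ | EBT ∅ (mkPt b f : PtR ι ρ ν κ) ∈ 𝓔} := by
    intro f f' hle hf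
    simp only [Set.mem_setOf_eq, EBT, flipT_empty_mkPt] at hf ⊢
    exact h𝓔 (ER_mono (mkPt_mono _ hle)) hf
  have hB : IsLowerSet {f : Config κ | EB (mkPt b f : PtR ι ρ ν κ) ∈ 𝓔} := by
    intro f f' hle hf
    simp only [Set.mem_setOf_eq, EB, flipPt_mkPt] at hf ⊢
    exact h𝓔 (ER_mono (mkPt_mono _ (MixedCube.flipAll_le_flipAll' hle))) hf
  have hAB : flipAll ⁻¹' {f : Config κ | EB (mkPt b f : PtR ι ρ ν κ) ∈ 𝓔} =
      {f : Config κ | EBT ∅ (mkPt b f : PtR ι ρ ν κ) ∈ 𝓔} := by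
    ext f
    simp only [Set.mem_preimage, Set.mem_setOf_eq, EB, EBT, flipPt_mkPt, flipT_empty_mkPt,
      flipAll_involutive f]
  have key := LocRows.card_inter_le_of_cube hEv hA hB hAB
  have e1 : N (fun f : Config κ => (fun q : PtR ι ρ ν κ => q ∈ Q ∧ ¬ Leak q arm ∧ EBT ∅ q ∈ 𝓔)
        (mkPt b f)) =
      (Finset.univ.filter (· ∈ {f : Config κ | (mkPt b f : PtR ι ρ ν κ) ∈ Q ∧ ¬ Leak (mkPt b f) arm} ∩
        {f : Config κ | EBT ∅ (mkPt b f : PtR ι ρ ν κ) ∈ 𝓔})).card := by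
    unfold N
    congr 1
    ext f
    simp only [Finset.mem_filter, Finset.mem_univ, true_and, Set.mem_inter_iff, Set.mem_setOf_eq,
      and_assoc]
  have e2 : N (fun f : Config κ => (fun q : PtR ι ρ ν κ => q ∈ Q ∧ ¬ Leak q arm ∧ EB q ∈ 𝓔)
        (mkPt b f)) =
      (Finset.univ.filter (· ∈ {f : Config κ | (mkPt b f : PtR ι ρ ν κ) ∈ Q ∧ ¬ Leak (mkPt b f) arm} ∩
        {f : Config κ | EB (mkPt b f : PtR ι ρ ν κ) ∈ 𝓔})).card := by
    unfold N
    congr 1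
    ext f
    simp only [Finset.mem_filter, Finset.mem_univ, true_and, Set.mem_inter_iff, Set.mem_setOf_eq,
      and_assoc]
  rw [e1, e2]
  convert key using 2 <;> first | rfl | (ext x; simp only [Finset.mem_filter, Finset.mem_univ, true_and])

/-- **THE SEVERAL-ARMS BIG-BLOCK LEMMA UNDER THE GEOMETRIC CLOSURE, PURE ARMS**: for every set `Q`
closed, between non-leaking points, under the raw-lower moves with the u–p condition and under
raising `uP`, and every up-set `𝓔`, the count of non-leaking points of `Q` with red set in `𝓔` is
at most the count with blue set in `𝓔`. -/
theorem pureArms_card_le (hL : ArmLower arm Q) (hR : RaiseUP arm Q)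
    {𝓔 : Set (Set (AtomR ι ρ ν κ))} (h𝓔 : IsUpperSet 𝓔) :
    (Finset.univ.filter fun p : PtR ι ρ ν κ => p ∈ Q ∧ ¬ Leak p arm ∧ ER p ∈ 𝓔).card ≤
      (Finset.univ.filter fun p : PtR ι ρ ν κ => p ∈ Q ∧ ¬ Leak p arm ∧ EB p ∈ 𝓔).card := by
  have e1 : (Finset.univ.filter fun p : PtR ι ρ ν κ => p ∈ Q ∧ ¬ Leak p arm ∧ ER p ∈ 𝓔).card =
      N (fun p : PtR ι ρ ν κ => p ∈ Q ∧ ¬ Leak p arm ∧ ER p ∈ 𝓔) := by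
    unfold N
    congr 1
    ext p
    simp only [Finset.mem_filter, Finset.mem_univ, true_and]
  have e2 : (Finset.univ.filter fun p : PtR ι ρ ν κ => p ∈ Q ∧ ¬ Leak p arm ∧ EB p ∈ 𝓔).card =
      N (fun p : PtR ι ρ ν κ => p ∈ Q ∧ ¬ Leak p arm ∧ EB p ∈ 𝓔) := by
    unfold N
    congr 1
    ext p
    simp only [Finset.mem_filter, Finset.mem_univ, true_and]
  rw [e1, e2]
  exact le_trans (frozen_card_le hL hR h𝓔) (far_card_le hL h𝓔)

end Sum

section Transfer

open LocRows

variable {V : Type*} {E : Type*} [Fintype E]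
variable [IsEmpty ν] [Nonempty ι] [Fintype ι] [DecidableEq ι] [Fintype ρ] [DecidableEq ρ]
  [Fintype ν] [DecidableEq ν] [Fintype κ] [DecidableEq κ] {arm : ν → ρ}

/-- **The several-arms big-block principle under the geometric closure, edge-set form** (pure
arms): a block `C` of configurations that is the injective image of the non-leaking points of the
raw cube under a realisation `r`, on which the red edge set of `h` is the image of the abstract red
set under a monotone map `φ` (and the blue edge set the image of `EB`), and whose conditioning
pulls back to a set closed under the raw-lower moves with the u–p condition and under raising
`uP`, satisfies the rigid counting inequality on `C ∩ Qs` for every up-set `𝓔` of edge sets —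
the twin of `card_le_of_mixedArms_edges` with the hypotheses the several-arms geometry provides
(`MixedBaseR.mem_tgtU_of_le`, `MixedBaseR.mem_tgtU_of_uP_le`). -/
theorem card_le_of_pureArms_edges {ends : E → Sym2 V} (r : PtR ι ρ ν κ → Config E)
    (hr : ∀ p q, ¬ Leak p arm → ¬ Leak q arm → r p = r q → p = q) (C : Finset (Config E))
    (hC : ∀ ζ, ζ ∈ C ↔ ∃ p, ¬ Leak p arm ∧ r p = ζ) (Qs : Set (Config E))
    (hEv : ArmLower arm {p | r p ∈ Qs}) (hRa : RaiseUP arm {p | r p ∈ Qs}) (h : V)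
    (φ : Set (AtomR ι ρ ν κ) → Set E) (hφ : Monotone φ)
    (hR : ∀ p, ¬ Leak p arm → redEdges ends (r p) h = φ (ER p))
    (hB : ∀ p, ¬ Leak p arm → blueEdges ends (r p) h = φ (EB p))
    {𝓔 : Set (Set E)} (h𝓔 : IsUpperSet 𝓔) :
    (C.filter fun ζ => ζ ∈ Qs ∧ redEdges ends ζ h ∈ 𝓔).card ≤
      (C.filter fun ζ => ζ ∈ Qs ∧ blueEdges ends ζ h ∈ 𝓔).card := by
  have e1 : (C.filter fun ζ => ζ ∈ Qs ∧ redEdges ends ζ h ∈ 𝓔) =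
      (Finset.univ.filter fun p : PtR ι ρ ν κ =>
        r p ∈ Qs ∧ ¬ Leak p arm ∧ ER p ∈ φ ⁻¹' 𝓔).image r := by
    ext ζ
    simp only [Finset.mem_filter, Finset.mem_image, Finset.mem_univ, true_and, Set.mem_preimage]
    constructor
    · rintro ⟨hζ, hQ, hE⟩
      obtain ⟨p, hp, rfl⟩ := (hC ζ).1 hζ
      refine ⟨p, ⟨hQ, hp, ?_⟩, rfl⟩
      rw [← hR p hp]
      exact hE
    · rintro ⟨p, ⟨hQ, hp, hE⟩, rfl⟩
      refine ⟨(hC _).2 ⟨p, hp, rfl⟩, hQ, ?_⟩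
      rw [hR p hp]
      exact hE
  have e2 : (C.filter fun ζ => ζ ∈ Qs ∧ blueEdges ends ζ h ∈ 𝓔) =
      (Finset.univ.filter fun p : PtR ι ρ ν κ =>
        r p ∈ Qs ∧ ¬ Leak p arm ∧ EB p ∈ φ ⁻¹' 𝓔).image r := by
    ext ζ
    simp only [Finset.mem_filter, Finset.mem_image, Finset.mem_univ, true_and, Set.mem_preimage]
    constructor
    · rintro ⟨hζ, hQ, hE⟩
      obtain ⟨p, hp, rfl⟩ := (hC ζ).1 hζ
      refine ⟨p, ⟨hQ, hp, ?_⟩, rfl⟩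
      rw [← hB p hp]
      exact hE
    · rintro ⟨p, ⟨hQ, hp, hE⟩, rfl⟩
      refine ⟨(hC _).2 ⟨p, hp, rfl⟩, hQ, ?_⟩
      rw [hB p hp]
      exact hE
  have inj1 : Set.InjOn r
      ↑(Finset.univ.filter fun p : PtR ι ρ ν κ => r p ∈ Qs ∧ ¬ Leak p arm ∧ ER p ∈ φ ⁻¹' 𝓔) := by
    intro p hp q hq hpq
    simp only [Finset.coe_filter, Finset.mem_univ, true_and, Set.mem_setOf_eq] at hp hq
    exact hr p q hp.2.1 hq.2.1 hpq
  have inj2 : Set.InjOn r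
      ↑(Finset.univ.filter fun p : PtR ι ρ ν κ => r p ∈ Qs ∧ ¬ Leak p arm ∧ EB p ∈ φ ⁻¹' 𝓔) := by
    intro p hp q hq hpq
    simp only [Finset.coe_filter, Finset.mem_univ, true_and, Set.mem_setOf_eq] at hp hq
    exact hr p q hp.2.1 hq.2.1 hpq
  rw [e1, e2, Finset.card_image_of_injOn inj1, Finset.card_image_of_injOn inj2]
  have h𝓔' : IsUpperSet (φ ⁻¹' 𝓔) := by
    intro S S' hSS' hS
    exact h𝓔 (hφ hSS') hS
  exact pureArms_card_le (Q := {p | r p ∈ Qs}) hEv hRa h𝓔'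

end Transfer

end MixedArms

end Summit.Ventures.PercRepro2
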